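import Mathlib.Topology.Algebra.InfiniteSum.Constructions
import Mathlib.Topology.Algebra.InfiniteSum.ENNReal
import Summits.CriticalPhenomena.SAWScalingLimit.Theorems.SAWTotalPositivityBoundaryTP2Defs
import Summits.CriticalPhenomena.SAWScalingLimit.Theorems.SAWTotalPositivityBoundaryTP2Strip4RecPair312Aux
import Summits.CriticalPhenomena.SAWScalingLimit.Theorems.EdgeOfPositivity.Negative.EdgeOfPositivityRectDomain
import HarnessLib

/-!
# Crux `BoundaryTP2` (stmt-CriticalPhenomena-7115), line `Sketch`: width-4 transfer, the pair kernel
with the loop at the middle pair of the last column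

Tool stub `stub_strip4_recPair312` (W4-C6) of the 4-row strip programme. On
`S_L = discreteDomainGraph (rectDomain L 3) 1` (sites `{0..L} × {0,1,2,3}`), rows labelled
`ρ ∈ {(0,1,2,3), (3,2,1,0)}` (mirror images), write `a = (0,r)`, `p_j = (L,ρ_j)`, `m_j = (L+1,ρ_j)`.
The disjoint-pair kernel of `S_{L+1}` over the vertex-disjoint pairs of self-avoiding paths
`(γ : a → m₃, γ' : m₁ → m₂)` satisfies, for all `L` and `x ≥ 0`,

  `PP_{S_{L+1}}(a → m₃ ; m₁ → m₂) = x² Z_{S_L}(a,p₃) + x⁴ PP_{S_L}(a → p₃ ; p₀ → p₂)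
                                      + x³ PP_{S_L}(a → p₃ ; p₁ → p₂)`.

Proof: `γ` enters `m₃` from `p₃` (`m₂ ∈ γ'`) after a path `γ₀ : a → p₃` of `S_L` (it avoids
`m₁, m₂ ∈ γ'` and the dead end `m₀`, whose neighbours are `p₀` and `m₁ ∉ γ`). The loop `γ'` leaves
`m₁` along the rung to `m₂` (term `x² Z`), or to the corner `m₀`, forced on to `p₀`, re-entering `m₂`
from `p₂` (`m₃ ∈ γ`) after a path `δ : p₀ → p₂` of `S_L` (term `x⁴ PP`), or to `p₁`, re-entering
`m₂` from `p₂` after a path `δ : p₁ → p₂` of `S_L` (term `x³ PP`). The gluing map and its properties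
are `strip4_recPair312_glue` (…Strip4RecPair312Aux); here the sum is transported along it
(`Function.Injective.tsum_eq`, `Summable.tsum_sum`: `s4p312_abstract`) and the strip instance is
coordinate bookkeeping on `Site 2` closed by `omega` (after `…Strip3RecPair`).
-/

noncomputable section

namespace Summit.CriticalPhenomena.SAWScalingLimit.Theorems.BoundaryTP2

open SimpleGraph Walk
open Literature.Probability.LatticeModels Literature.Probability.RandomPlanarGeometry
open Summit.CriticalPhenomena.SAWScalingLimit.Theorems.EdgeOfPositivity.Negative
open scoped ENNReal

variable {V : Type*}

/-! ## The recursion, abstract form -/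

open Classical in
/-- **The disjoint-pair recursion, abstract form.** In the setting of `strip4_recPair312_glue`, for
`x ≥ 0`, `Σ_{(γ,γ') disjoint} x^{|γ|+|γ'|} = x² Z_{G₀}(a,ps) + x⁴ Σ_{(γ₀,δ) disjoint, δ : pc → psb}
x^{|γ₀|+|δ|} + x³ Σ_{(γ₀,δ) disjoint, δ : p1 → psb} x^{|γ₀|+|δ|}`: reparametrise the disjoint pairs by
the gluing map (`Function.Injective.tsum_eq`) and split the sum over the three classes
(`Summable.tsum_sum`). [folklore] -/
private theorem s4p312_abstract {G₀ G : SimpleGraph V} {a ps p1 psb pc t m tb c : V} (x : ℝ)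
    (hx : 0 ≤ x) (hle : G₀ ≤ G)
    (hold : ∀ u v, G.Adj u v → (u ≠ t ∧ u ≠ m ∧ u ≠ tb ∧ u ≠ c) →
      (v ≠ t ∧ v ≠ m ∧ v ≠ tb ∧ v ≠ c) → G₀.Adj u v)
    (hG₀ : ∀ u v, G₀.Adj u v → v ≠ t ∧ v ≠ m ∧ v ≠ tb ∧ v ≠ c)
    (ha : a ≠ t ∧ a ≠ m ∧ a ≠ tb ∧ a ≠ c) (hp1 : p1 ≠ t ∧ p1 ≠ m ∧ p1 ≠ tb ∧ p1 ≠ c)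
    (hpc : pc ≠ t ∧ pc ≠ m ∧ pc ≠ tb ∧ pc ≠ c)
    (hpt : G.Adj ps t) (hmtb : G.Adj m tb) (hmp1 : G.Adj m p1) (hptb : G.Adj psb tb)
    (hmc : G.Adj m c) (hcpc : G.Adj c pc)
    (hNt : ∀ u, G.Adj t u → u = ps ∨ u = tb) (hNm : ∀ u, G.Adj m u → u = p1 ∨ u = c ∨ u = tb)
    (hNtb : ∀ u, G.Adj tb u → u = psb ∨ u = m ∨ u = t) (hNc : ∀ u, G.Adj c u → u = pc ∨ u = m)
    (htm : t ≠ m) (httb : t ≠ tb) (htc : t ≠ c) (hmtb' : m ≠ tb) (hmc' : m ≠ c) (htbc : tb ≠ c) :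
    (∑' (γ : G.Path a t) (γ' : G.Path m tb),
      (if List.Disjoint γ.1.support γ'.1.support then
        ENNReal.ofReal (x ^ γ.1.length) * ENNReal.ofReal (x ^ γ'.1.length) else 0)) =
      ENNReal.ofReal (x ^ 2) * pathKernel G₀ x a ps +
        ENNReal.ofReal (x ^ 4) *
          (∑' (γ : G₀.Path a ps) (γ' : G₀.Path pc psb),
            (if List.Disjoint γ.1.support γ'.1.support then
              ENNReal.ofReal (x ^ γ.1.length) * ENNReal.ofReal (x ^ γ'.1.length) else 0)) +
        ENNReal.ofReal (x ^ 3) *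
          (∑' (γ : G₀.Path a ps) (γ' : G₀.Path p1 psb),
            (if List.Disjoint γ.1.support γ'.1.support then
              ENNReal.ofReal (x ^ γ.1.length) * ENNReal.ofReal (x ^ γ'.1.length) else 0)) := by
  obtain ⟨g, hinj, hrange, hA, hB, hC⟩ := strip4_recPair312_glue hle hold hG₀ ha hp1 hpc hpt hmtb hmp1
    hptb hmc hcpc hNt hNm hNtb hNc htm httb htc hmtb' hmc' htbc
  -- the double sum as a sum over pairs, reparametrised by `g`
  have h1 : (∑' (γ : G.Path a t) (γ' : G.Path m tb),
      (if List.Disjoint γ.1.support γ'.1.support then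
        ENNReal.ofReal (x ^ γ.1.length) * ENNReal.ofReal (x ^ γ'.1.length) else 0)) =
      ∑' s, (if List.Disjoint (g s).1.1.support (g s).2.1.support then
        ENNReal.ofReal (x ^ (g s).1.1.length) * ENNReal.ofReal (x ^ (g s).2.1.length) else 0) :=
    calc _ = ∑' q : G.Path a t × G.Path m tb, (if List.Disjoint q.1.1.support q.2.1.support then
          ENNReal.ofReal (x ^ q.1.1.length) * ENNReal.ofReal (x ^ q.2.1.length) else 0) :=
        (ENNReal.tsum_prod (f := fun (γ : G.Path a t) (γ' : G.Path m tb) =>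
          if List.Disjoint γ.1.support γ'.1.support then
            ENNReal.ofReal (x ^ γ.1.length) * ENNReal.ofReal (x ^ γ'.1.length) else 0)).symm
      _ = _ := by
        refine (hinj.tsum_eq (f := fun q : G.Path a t × G.Path m tb =>
          if List.Disjoint q.1.1.support q.2.1.support then
            ENNReal.ofReal (x ^ q.1.1.length) * ENNReal.ofReal (x ^ q.2.1.length) else 0) ?_).symm
        intro q hq
        rw [Function.mem_support] at hq
        refine hrange q ?_
        by_contra hd
        exact hq (if_neg hd)
  -- the weights on the three classes
  have h2 : ∀ γ₀ : G₀.Path a ps,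
      (if List.Disjoint (g (Sum.inl γ₀)).1.1.support (g (Sum.inl γ₀)).2.1.support then
        ENNReal.ofReal (x ^ (g (Sum.inl γ₀)).1.1.length) *
          ENNReal.ofReal (x ^ (g (Sum.inl γ₀)).2.1.length) else 0) =
      ENNReal.ofReal (x ^ 2) * ENNReal.ofReal (x ^ γ₀.1.length) := by
    intro γ₀
    obtain ⟨hd, hl1, hl2⟩ := hA γ₀
    rw [if_pos hd, hl1, hl2, ← ENNReal.ofReal_mul (pow_nonneg hx _),
      ← ENNReal.ofReal_mul (pow_nonneg hx _)]
    congr 1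
    ring
  have h34 : ∀ {u : V} (k : ℕ) (q : G₀.Path a ps × G₀.Path u psb) (Q : G.Path a t × G.Path m tb),
      ((List.Disjoint Q.1.1.support Q.2.1.support ↔ List.Disjoint q.1.1.support q.2.1.support) ∧
        Q.1.1.length = q.1.1.length + 1 ∧ Q.2.1.length = q.2.1.length + k) →
      (if List.Disjoint Q.1.1.support Q.2.1.support then
        ENNReal.ofReal (x ^ Q.1.1.length) * ENNReal.ofReal (x ^ Q.2.1.length) else 0) =
      ENNReal.ofReal (x ^ (k + 1)) * (if List.Disjoint q.1.1.support q.2.1.support then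
        ENNReal.ofReal (x ^ q.1.1.length) * ENNReal.ofReal (x ^ q.2.1.length) else 0) := by
    rintro u k q Q ⟨hd, hl1, hl2⟩
    by_cases h : List.Disjoint q.1.1.support q.2.1.support
    · rw [if_pos (hd.2 h), if_pos h, hl1, hl2, ← ENNReal.ofReal_mul (pow_nonneg hx _),
        ← ENNReal.ofReal_mul (pow_nonneg hx _), ← ENNReal.ofReal_mul (pow_nonneg hx _)]
      congr 1
      ring
    · rw [if_neg (fun h' => h (hd.1 h')), if_neg h, mul_zero]
  rw [h1, Summable.tsum_sum ENNReal.summable ENNReal.summable,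
    Summable.tsum_sum ENNReal.summable ENNReal.summable, tsum_congr h2,
    tsum_congr fun q => h34 3 q _ (hB q), tsum_congr fun q => h34 2 q _ (hC q),
    ENNReal.tsum_mul_left, ENNReal.tsum_mul_left, ENNReal.tsum_mul_left,
    ENNReal.tsum_prod (f := fun (γ : G₀.Path a ps) (γ' : G₀.Path pc psb) =>
      if List.Disjoint γ.1.support γ'.1.support then
        ENNReal.ofReal (x ^ γ.1.length) * ENNReal.ofReal (x ^ γ'.1.length) else 0),
    ENNReal.tsum_prod (f := fun (γ : G₀.Path a ps) (γ' : G₀.Path p1 psb) =>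
      if List.Disjoint γ.1.support γ'.1.support then
        ENNReal.ofReal (x ^ γ.1.length) * ENNReal.ofReal (x ^ γ'.1.length) else 0), ← add_assoc]
  rfl

/-! ## Coordinates on the 4-row strip -/

/-- Adjacency in `ℤ²` in coordinates. [folklore] -/
private theorem s4p312_zd_adj_iff (u v : Site 2) :
    (zdGraph 2).Adj u v ↔ ((v 0 = u 0 + 1 ∨ u 0 = v 0 + 1) ∧ v 1 = u 1) ∨
      ((v 1 = u 1 + 1 ∨ u 1 = v 1 + 1) ∧ v 0 = u 0) := by
  -- adapted from `ladder_zd_adj_iff` (…BoundaryTP2LadderKernels)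
  rw [zdGraph_adj_iff, Fin.exists_fin_two]
  simp only [funext_iff, Fin.forall_fin_two, Pi.add_apply, Pi.single_eq_same,
    Pi.single_eq_of_ne (one_ne_zero : (1 : Fin 2) ≠ 0),
    Pi.single_eq_of_ne (zero_ne_one : (0 : Fin 2) ≠ 1), add_zero]
  omega

/-- A site equals `st a b` iff its two coordinates are `a` and `b`. [folklore] -/
private theorem s4p312_eq_st_iff (v : Site 2) (a b : ℤ) : v = st a b ↔ v 0 = a ∧ v 1 = b :=
  ⟨fun h => h ▸ ⟨rfl, rfl⟩, fun h => by rw [← st_eta v, h.1, h.2]⟩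

/-- Adjacency of the strip `{0..n} × {0,1,2,3}` in coordinates. [folklore] -/
private theorem s4p312_adj_iff (n : ℕ) (u v : Site 2) :
    (discreteDomainGraph (rectDomain n 3) 1).Adj u v ↔
      (((v 0 = u 0 + 1 ∨ u 0 = v 0 + 1) ∧ v 1 = u 1) ∨ ((v 1 = u 1 + 1 ∨ u 1 = v 1 + 1) ∧ v 0 = u 0)) ∧
        ((0 ≤ u 0 ∧ u 0 ≤ n) ∧ (0 ≤ u 1 ∧ u 1 ≤ 3)) ∧ ((0 ≤ v 0 ∧ v 0 ≤ n) ∧ (0 ≤ v 1 ∧ v 1 ≤ 3)) := by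
  rw [adj_rect_iff, s4p312_zd_adj_iff, mem_rectSites_iff, mem_rectSites_iff, Nat.cast_ofNat]

/-- The sites of `S_L` are the sites of `S_{L+1}` off the new column `L+1`. [folklore] -/
private theorem s4p312_mem_old_iff (L : ℕ) (r0 r1 r2 r3 : ℤ)
    (hρ : (r0 = 0 ∧ r1 = 1 ∧ r2 = 2 ∧ r3 = 3) ∨ (r0 = 3 ∧ r1 = 2 ∧ r2 = 1 ∧ r3 = 0)) (u : Site 2) :
    u ∈ rectSites L 3 ↔ u ∈ rectSites (L + 1) 3 ∧ (u ≠ st (L + 1 : ℕ) r3 ∧ u ≠ st (L + 1 : ℕ) r1 ∧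
      u ≠ st (L + 1 : ℕ) r2 ∧ u ≠ st (L + 1 : ℕ) r0) := by
  rw [mem_rectSites_iff, mem_rectSites_iff, Ne, Ne, Ne, Ne, s4p312_eq_st_iff, s4p312_eq_st_iff,
    s4p312_eq_st_iff, s4p312_eq_st_iff]
  omega

/-- The six edges of `S_{L+1}` at its last column used by the gluing, and the distinctness of the four
sites of that column. [folklore] -/
private theorem s4p312_column (L : ℕ) (r0 r1 r2 r3 : ℤ)
    (hρ : (r0 = 0 ∧ r1 = 1 ∧ r2 = 2 ∧ r3 = 3) ∨ (r0 = 3 ∧ r1 = 2 ∧ r2 = 1 ∧ r3 = 0)) :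
    ((discreteDomainGraph (rectDomain (L + 1) 3) 1).Adj (st L r3) (st (L + 1 : ℕ) r3) ∧
      (discreteDomainGraph (rectDomain (L + 1) 3) 1).Adj (st (L + 1 : ℕ) r1) (st (L + 1 : ℕ) r2) ∧
      (discreteDomainGraph (rectDomain (L + 1) 3) 1).Adj (st (L + 1 : ℕ) r1) (st L r1) ∧
      (discreteDomainGraph (rectDomain (L + 1) 3) 1).Adj (st L r2) (st (L + 1 : ℕ) r2) ∧
      (discreteDomainGraph (rectDomain (L + 1) 3) 1).Adj (st (L + 1 : ℕ) r1) (st (L + 1 : ℕ) r0) ∧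
      (discreteDomainGraph (rectDomain (L + 1) 3) 1).Adj (st (L + 1 : ℕ) r0) (st L r0)) ∧
    (st (L + 1 : ℕ) r3 ≠ st (L + 1 : ℕ) r1 ∧ st (L + 1 : ℕ) r3 ≠ st (L + 1 : ℕ) r2 ∧
      st (L + 1 : ℕ) r3 ≠ st (L + 1 : ℕ) r0 ∧ st (L + 1 : ℕ) r1 ≠ st (L + 1 : ℕ) r2 ∧
      st (L + 1 : ℕ) r1 ≠ st (L + 1 : ℕ) r0 ∧ st (L + 1 : ℕ) r2 ≠ st (L + 1 : ℕ) r0) := by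
  refine ⟨?_, ?_⟩
  · refine ⟨?_, ?_, ?_, ?_, ?_, ?_⟩
    all_goals rw [s4p312_adj_iff]; dsimp only [st_zero, st_one]; omega
  · simp only [Ne, s4p312_eq_st_iff, st_zero, st_one]
    omega

/-- The neighbours, in `S_{L+1}`, of the four sites of its last column. [folklore] -/
private theorem s4p312_nbrs (L : ℕ) (r0 r1 r2 r3 : ℤ)
    (hρ : (r0 = 0 ∧ r1 = 1 ∧ r2 = 2 ∧ r3 = 3) ∨ (r0 = 3 ∧ r1 = 2 ∧ r2 = 1 ∧ r3 = 0)) :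
    (∀ u, (discreteDomainGraph (rectDomain (L + 1) 3) 1).Adj (st (L + 1 : ℕ) r3) u →
        u = st L r3 ∨ u = st (L + 1 : ℕ) r2) ∧
      (∀ u, (discreteDomainGraph (rectDomain (L + 1) 3) 1).Adj (st (L + 1 : ℕ) r1) u →
        u = st L r1 ∨ u = st (L + 1 : ℕ) r0 ∨ u = st (L + 1 : ℕ) r2) ∧
      (∀ u, (discreteDomainGraph (rectDomain (L + 1) 3) 1).Adj (st (L + 1 : ℕ) r2) u →
        u = st L r2 ∨ u = st (L + 1 : ℕ) r1 ∨ u = st (L + 1 : ℕ) r3) ∧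
      (∀ u, (discreteDomainGraph (rectDomain (L + 1) 3) 1).Adj (st (L + 1 : ℕ) r0) u →
        u = st L r0 ∨ u = st (L + 1 : ℕ) r1) := by
  refine ⟨fun u h => ?_, fun u h => ?_, fun u h => ?_, fun u h => ?_⟩
  all_goals
    rw [s4p312_adj_iff] at h
    simp only [s4p312_eq_st_iff]
    dsimp only [st_zero, st_one] at h
    omega

/-! ## The recursion -/

open Classical in
/-- STUB W4-C6 (`stub_strip4_recPair312`). Recursion of the disjoint-pair kernel (main to `(L+1,ρ₃)`, loop `(L+1,ρ₁) → (L+1,ρ₂)`). [folklore] -/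
theorem stub_strip4_recPair312 (L : ℕ) {x : ℝ} (hx : 0 ≤ x) (r : ℤ) (hr : 0 ≤ r ∧ r ≤ 3) (r0 r1 r2 r3 : ℤ)
    (hρ : (r0 = 0 ∧ r1 = 1 ∧ r2 = 2 ∧ r3 = 3) ∨ (r0 = 3 ∧ r1 = 2 ∧ r2 = 1 ∧ r3 = 0)) :
    (∑' (γ : (discreteDomainGraph (rectDomain (L + 1) 3) 1).Path (st 0 r) (st (L + 1 : ℕ) r3))
        (γ' : (discreteDomainGraph (rectDomain (L + 1) 3) 1).Path (st (L + 1 : ℕ) r1) (st (L + 1 : ℕ) r2)),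
      (if List.Disjoint γ.1.support γ'.1.support then
        ENNReal.ofReal (x ^ γ.1.length) * ENNReal.ofReal (x ^ γ'.1.length) else 0)) =
      ENNReal.ofReal (x ^ 2) * pathKernel (discreteDomainGraph (rectDomain L 3) 1) x (st 0 r) (st L r3) +
        ENNReal.ofReal (x ^ 4) *
          (∑' (γ : (discreteDomainGraph (rectDomain L 3) 1).Path (st 0 r) (st L r3))
              (γ' : (discreteDomainGraph (rectDomain L 3) 1).Path (st L r0) (st L r2)),
            (if List.Disjoint γ.1.support γ'.1.support then
              ENNReal.ofReal (x ^ γ.1.length) * ENNReal.ofReal (x ^ γ'.1.length) else 0)) +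
        ENNReal.ofReal (x ^ 3) *
          (∑' (γ : (discreteDomainGraph (rectDomain L 3) 1).Path (st 0 r) (st L r3))
              (γ' : (discreteDomainGraph (rectDomain L 3) 1).Path (st L r1) (st L r2)),
            (if List.Disjoint γ.1.support γ'.1.support then
              ENNReal.ofReal (x ^ γ.1.length) * ENNReal.ofReal (x ^ γ'.1.length) else 0)) := by
  obtain ⟨⟨hpt, hmtb, hmp1, hptb, hmc, hcpc⟩, htm, httb, htc, hmtb', hmc', htbc⟩ :=
    s4p312_column L r0 r1 r2 r3 hρ
  obtain ⟨hNt, hNm, hNtb, hNc⟩ := s4p312_nbrs L r0 r1 r2 r3 hρ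
  have ha : st 0 r ∈ rectSites L 3 := by rw [mem_rectSites_iff, st_zero, st_one]; omega
  have hp1 : st (L : ℤ) r1 ∈ rectSites L 3 := by rw [mem_rectSites_iff, st_zero, st_one]; omega
  have hpc : st (L : ℤ) r0 ∈ rectSites L 3 := by rw [mem_rectSites_iff, st_zero, st_one]; omega
  have hold := s4p312_mem_old_iff L r0 r1 r2 r3 hρ
  exact s4p312_abstract x hx
    (fun u v h => by
      rw [adj_rect_iff] at h ⊢
      exact ⟨h.1, ((hold u).1 h.2.1).1, ((hold v).1 h.2.2).1⟩)
    (fun u v h hu hv => by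
      rw [adj_rect_iff] at h ⊢
      exact ⟨h.1, (hold u).2 ⟨h.2.1, hu⟩, (hold v).2 ⟨h.2.2, hv⟩⟩)
    (fun u v h => ((hold v).1 (adj_rect_iff.1 h).2.2).2)
    ((hold _).1 ha).2 ((hold _).1 hp1).2 ((hold _).1 hpc).2 hpt hmtb hmp1 hptb hmc hcpc
    hNt hNm hNtb hNc htm httb htc hmtb' hmc' htbc

end Summit.CriticalPhenomena.SAWScalingLimit.Theorems.BoundaryTP2
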